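import Mathlib
import Literature.MathematicalPhysics.QuantumFieldTheory.MagnenRivasseauSeneor1993.MRS93MainStatementPinned
import HarnessLib

/-!
# Magnen–Rivasseau–Sénéor, *Construction of YM₄ with an infrared cutoff* (CMP 155, 1993), the MAIN STATEMENT p.327 —
# WHAT THE PRINTED SENTENCE DELIVERS IN THE ULTRAVIOLET LIMIT, over the pinned carrier: the consumer face of
# `PinnedTheory.PrintedStatement` (normalisation, symmetry and the axial gauge survive the limit unconditionally;
# under the first half of the sentence the limit Schwinger functions are a POSITIVE functional on the polynomial
# algebra of the field coordinates, with the two-point Cauchy–Schwarz inequality; under the whole sentence (VIII.6)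
# holds for them in the finitary form) — and, stated honestly, what it does not deliver

statement-level skeleton of a published CLAIM with citation tags; the elementary passage to the limit proved;
nothing here is a claim about the Yang–Mills mass gap, about continuum Yang–Mills on `T⁴` without infrared cutoff,
or about the Clay problem — and nothing of Magnen–Rivasseau–Sénéor's analysis is asserted or formalised

**Citation header (reproduction of PUBLISHED work).** J. Magnen, V. Rivasseau, R. Sénéor, *Construction of YM₄ with
an infrared cutoff*, Commun. Math. Phys. **155** (1993) 325–383 [MagnenRivasseauSeneor1993]: the main statement
p.327 tl.39–43; p.378 tl.17–22 (normalized Schwinger functions with cutoff and their limit); (II.7) p.329 tl.20–21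
and p.329 tl.32–34 (axial gauge, no Euclidean invariance); p.327 tl.29–32 (OS axioms not studied); (VIII.6) p.378.
Loci `p.NNN tl.nn` = journal page / text-layer line of the held scan `paper:magnen1993-cmp155-mrs-ym4-infrared-cutoff`.
Cell pub-balaban-gaps, track G3 («MRS 1993 typed AS PRINTED»), seat mrs-lit-1 (gen 19); companion prose
`run/shared/lean/pub/pub-balaban-gaps/g3/MRS-AS-PRINTED.md` §2, §5. Builds on `…MRS93MainStatementPinned` (gen 0:
`PinnedTheory`, `schwinger`, `toAxialTheory`, `PrintedStatement`, the per-cutoff facts `schwinger_empty` /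
`schwinger_perm` / `schwinger_sq_nonneg` / `schwinger_time`, `tendsto_finitaryWard`) and `…MRS93MainStatement`
(`AxialTheory.Slim` = the limit values, `UVLimitExistsPrinted`, `SlavnovPrinted`, `tendsto_Slim_of_uvLimitExists`).

**Why this file.** The tree types the main statement as a HYPOTHESIS (`PrintedStatement`, never a theorem) and
proves the elementary facts about the CUT-OFF Schwinger functions `⟨·⟩_{ax,ρ}`; a consumer who assumes MRS («MRS as
hypothesis», record §4) wants to know what follows for the LIMIT functions `lim_{ρ→∞}⟨·⟩_{ax,ρ}` the sentence
asserts to exist. This leaf collects exactly that, each item with the printed sentence it comes from, and says in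
the same place what does NOT follow.

**What the paper prints (verbatim).** p.327 tl.39–43: *«The ultraviolet limit as ρ → ∞ of the Schwinger functions
which are the moments of the bare measure defined below in (II.77) exists; futhermore [sic] these functions in the
ultraviolet limit satisfy the Slavnov identities (VIII.6) adapted to the particular infrared cutoff chosen.»*
p.378 tl.17–22: *«⟨·⟩_{ax,ρ}, the normalized functional integral of our theory with cutoff … When ρ → ∞, the
left-hand side, made of normalized Schwinger functions with cutoff ρ, by definition tends to the same Schwinger
functions without ultraviolet cutoff that we have constructed.»* p.329 tl.20–21, tl.32–34: *«This gauge is defined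
by the condition A₀ = 0. (II.7) … Remark also that (II.7) is not Euclidean invariant, and the corresponding
correlation functions are therefore not Euclidean invariant.»* p.327 tl.29–32: *«we cannot study the complete set of
Osterwalder-Schrader axioms … However we think that the main axiom, the OS positivity, could be shown to hold with
some additional work.»*

**What is typed here (bookkeeping kernel-checked, zero `sorry`, zero named facts).**
* §1 UNCONDITIONAL (true of the limit VALUES `Slim` whether or not the limit exists, because the cut-off sequences
  are constant resp. equal resp. zero): **`Slim_empty`** (`⟨1⟩_∞ = 1` — «normalized»), **`Slim_perm`** (symmetric in
  the test datum), **`Slim_time`** (every moment with a time index `μ = 0` vanishes — the axial gauge (II.7) survives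
  the limit; hence no Euclidean invariance is to be expected, p.329 tl.32–34).
* §2 UNDER THE FIRST HALF OF THE SENTENCE (`UVLimitExistsPrinted`): `tendsto_schwinger_Slim` (the cut-off moments
  converge to `Slim`), `Slim_sq_nonneg` (`⟨Ã(m)²⟩_∞ ≥ 0`); `monomial_append` (`Π` over a concatenated datum = product),
  **`polyEval`** (a real polynomial `P = Σ_k c_k Π_j A(f_k j)` in finitely many coordinates), **`integral_polyEval_sq`**
  (`⟨P²⟩_{ax,ρ} = Σ_{k,l} c_k c_l ⟨Π f_k ++ f_l⟩_{ax,ρ}`), `schwinger_poly_sq_nonneg`, and **`Slim_poly_sq_nonneg`**: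
  `Σ_{k,l} c_k c_l S_∞(f_k ++ f_l) ≥ 0` — THE LIMIT SCHWINGER FUNCTIONS ARE A POSITIVE LINEAR FUNCTIONAL ON THE
  POLYNOMIAL ALGEBRA of the field coordinates (positivity of `⟨P²⟩_{ax,ρ}` passed to the limit); its two-coordinate
  case `schwinger_quadratic_nonneg` / `Slim_quadratic_nonneg`, the Cauchy–Schwarz inequality
  **`Slim_two_point_sq_le`** (`⟨Ã(m)Ã(m′)⟩_∞² ≤ ⟨Ã(m)²⟩_∞⟨Ã(m′)²⟩_∞`, by `discrim_le_zero`), and the degree-one case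
  **`Slim_gram_nonneg`** (the limit two-point function is a positive-semidefinite kernel on the modes; `append_single_single`),
  and for data of any arities the symmetrised inequality **`Slim_append_cauchySchwarz`**
  (`(S_∞(f ++ g) + S_∞(g ++ f))² ≤ 4 S_∞(f ++ f) S_∞(g ++ g)`, the case `ι = Bool`).
* §3 UNDER THE WHOLE SENTENCE (`PrintedStatement`): **`slavnov_finitary`** ((VIII.6) for the limit functions in the
  pinned finitary form `c₀ + Σ_k c_k S_∞(n_k, f_k) = E_N(x)` for every `N` and every Ward test datum — unfolded, no
  content added), `printedStatement_limit` (the conjunction a consumer gets: convergence ∧ ⟨1⟩_∞ = 1 ∧ symmetry ∧ axial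
  vanishing ∧ two-point positivity ∧ (VIII.6)); `diracModel_Slim_two_point` (gen 0's degenerate witness seen through this interface).

**What the sentence does NOT deliver (printed disclaimers; nothing typed as if it did).** A limiting MEASURE whose
moments are `Slim` (the sentence is about Schwinger FUNCTIONS; positivity on squares of polynomials, §2, is what
survives of «moments of a probability law» — it is NOT Osterwalder–Schrader / reflection positivity, which the print
explicitly does not claim, p.327 tl.29–32); Euclidean invariance (axial gauge, p.329 tl.32–34); removal of the
infrared cutoff (p.328 tl.4–5); uniqueness or analyticity in the parameters; anything of Bałaban's; and — above all —
the sentence itself, whose status in print is a CLAIM with a self-declared sketch of proof (p.327 tl.44–48): every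
theorem below takes it, or its first half, as a HYPOTHESIS.
-/

noncomputable section

open Filter Topology MeasureTheory Finset

namespace Literature.MathematicalPhysics.QuantumFieldTheory.MagnenRivasseauSeneor1993

namespace MainStatement

/-- The monomial of a concatenated test datum is the product of the monomials: `Π_{j<N+N′} A((f ++ g) j) =
(Π_j A(f j))·(Π_j A(g j))` — the product of two Schwinger integrands is a Schwinger integrand.
[cite: MagnenRivasseauSeneor1993, (VIII.1) p.377, p.378 tl.17–21] -/
theorem monomial_append {N N' : ℕ} (f : Fin N → Mode) (g : Fin N' → Mode) (A : Config) :
    monomial (Fin.append f g) A = monomial f A * monomial g A := by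
  unfold monomial
  rw [Fin.prod_univ_add]
  simp only [Fin.append_left, Fin.append_right]

/-- A real POLYNOMIAL in finitely many field coordinates, presented as a finite family of terms
`(c_k, n_k, f_k)`: `P(A) = Σ_k c_k Π_{j<n_k} A(f_k j)`. [cite: MagnenRivasseauSeneor1993, (VIII.1) p.377, p.378 tl.17–21] -/
def polyEval {ι : Type*} [Fintype ι] (c : ι → ℝ) (n : ι → ℕ) (f : (k : ι) → Fin (n k) → Mode) (A : Config) : ℝ :=
  ∑ k, c k * monomial (f k) A

/-- `P(A)² = Σ_{k,l} c_k c_l Π A(f_k ++ f_l)` — the square of a polynomial is again a finite combination of Schwinger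
integrands. [cite: MagnenRivasseauSeneor1993, (VIII.1) p.377] -/
theorem polyEval_sq {ι : Type*} [Fintype ι] (c : ι → ℝ) (n : ι → ℕ) (f : (k : ι) → Fin (n k) → Mode)
    (A : Config) :
    polyEval c n f A ^ 2 = ∑ k, ∑ l, c k * c l * monomial (Fin.append (f k) (f l)) A := by
  rw [sq, polyEval, Finset.sum_mul_sum]
  refine Finset.sum_congr rfl fun k _ => Finset.sum_congr rfl fun l _ => ?_
  rw [monomial_append]
  ring

namespace PinnedTheory

variable (T : PinnedTheory)

/-! ## §1 Unconditional: normalisation, symmetry and the axial gauge survive the limit -/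

/-- The limit values ARE `lim_{ρ→∞}` of the moments (unfolding gen 0's `AxialTheory.Slim` over the pinned carrier).
[cite: MagnenRivasseauSeneor1993, p.327 tl.40–41, p.378 tl.20–22] -/
theorem Slim_eq_limUnder (N : ℕ) (f : Fin N → Mode) :
    T.toAxialTheory.Slim N f = limUnder atTop (fun ρ => T.schwinger ρ N f) := rfl

/-- **`⟨1⟩_∞ = 1`**: the limit Schwinger functions are normalised («the normalized functional integral», p.378
tl.17) — unconditionally, the cut-off sequence being constant `1`. [cite: MagnenRivasseauSeneor1993, p.378 tl.17–22] -/
theorem Slim_empty (f : Fin 0 → Mode) : T.toAxialTheory.Slim 0 f = 1 := by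
  rw [Slim_eq_limUnder]
  have h : (fun ρ => T.schwinger ρ 0 f) = fun _ => (1 : ℝ) := funext fun ρ => T.schwinger_empty ρ f
  rw [h]
  exact tendsto_const_nhds.limUnder_eq

/-- **The limit Schwinger functions are symmetric** under permutations of the test datum — unconditionally (the
cut-off sequences coincide term by term, `schwinger_perm`). [cite: MagnenRivasseauSeneor1993, (VIII.1) p.377, p.378 tl.20–22] -/
theorem Slim_perm (N : ℕ) (f : Fin N → Mode) (σ : Equiv.Perm (Fin N)) :
    T.toAxialTheory.Slim N (f ∘ σ) = T.toAxialTheory.Slim N f := by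
  rw [Slim_eq_limUnder, Slim_eq_limUnder]
  have h : (fun ρ => T.schwinger ρ N (f ∘ σ)) = fun ρ => T.schwinger ρ N f :=
    funext fun ρ => T.schwinger_perm ρ N f σ
  rw [h]

/-- **The axial gauge survives the limit**: every limit Schwinger function with a time index (`μ = 0`) vanishes —
«A₀ = 0. (II.7) … the corresponding correlation functions are therefore not Euclidean invariant» (p.329) —
unconditionally (the cut-off sequence is identically `0`, `schwinger_time`). [cite: MagnenRivasseauSeneor1993, (II.7) p.329 tl.20–21, tl.32–34] -/
theorem Slim_time (N : ℕ) (f : Fin N → Mode) (h : ∃ j, (f j).IsTime) : T.toAxialTheory.Slim N f = 0 := by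
  rw [Slim_eq_limUnder]
  have h0 : (fun ρ => T.schwinger ρ N f) = fun _ => (0 : ℝ) := funext fun ρ => T.schwinger_time ρ N f h
  rw [h0]
  exact tendsto_const_nhds.limUnder_eq

/-! ## §2 Under the first half of the sentence: convergence, positivity on squares, Cauchy–Schwarz -/

/-- Under «The ultraviolet limit … of the Schwinger functions … exists» every cut-off moment converges to its limit
value. [cite: MagnenRivasseauSeneor1993, p.327 tl.40–41, p.378 tl.20–22] -/
theorem tendsto_schwinger_Slim (huv : UVLimitExistsPrinted T.toAxialTheory) (N : ℕ) (f : Fin N → Mode) :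
    Tendsto (fun ρ => T.schwinger ρ N f) atTop (𝓝 (T.toAxialTheory.Slim N f)) :=
  tendsto_Slim_of_uvLimitExists huv N f

/-- `⟨Ã(m)²⟩_∞ ≥ 0` (limit of nonnegative numbers, `schwinger_sq_nonneg`). [cite: MagnenRivasseauSeneor1993, p.327 tl.40–41, (VIII.1) p.377] -/
theorem Slim_sq_nonneg (huv : UVLimitExistsPrinted T.toAxialTheory) (m : Mode) :
    0 ≤ T.toAxialTheory.Slim 2 ![m, m] :=
  ge_of_tendsto' (T.tendsto_schwinger_Slim huv 2 ![m, m]) fun ρ => T.schwinger_sq_nonneg ρ m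

/-- **`⟨P²⟩_{ax,ρ} = Σ_{k,l} c_k c_l ⟨Π A(f_k ++ f_l)⟩_{ax,ρ}`**: the expectation of the square of a polynomial in the
cut-off theory is the corresponding finite combination of cut-off Schwinger functions (linearity of `⟨·⟩_{ax,ρ}` and
the finiteness of all moments, (K3)). [cite: MagnenRivasseauSeneor1993, (VIII.1) p.377, p.378 tl.17–21] -/
theorem integral_polyEval_sq {ι : Type*} [Fintype ι] (c : ι → ℝ) (n : ι → ℕ) (f : (k : ι) → Fin (n k) → Mode)
    (ρ : ℕ) :
    ∫ A, polyEval c n f A ^ 2 ∂(T.law ρ) =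
      ∑ k, ∑ l, c k * c l * T.schwinger ρ (n k + n l) (Fin.append (f k) (f l)) := by
  simp_rw [polyEval_sq]
  rw [integral_finsetSum _ (fun k _ => ?_)]
  · refine Finset.sum_congr rfl fun k _ => ?_
    rw [integral_finsetSum _ (fun l _ => ?_)]
    · refine Finset.sum_congr rfl fun l _ => ?_
      rw [integral_const_mul]
      rfl
    · exact (T.integrable ρ _ _).const_mul _
  · exact integrable_finsetSum _ fun l _ => (T.integrable ρ _ _).const_mul _

/-- `⟨P²⟩_{ax,ρ} ≥ 0` for every cutoff `ρ`: `Σ_{k,l} c_k c_l ⟨Π A(f_k ++ f_l)⟩_{ax,ρ} ≥ 0` (it is the integral of a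
square against the probability law `⟨·⟩_{ax,ρ}`). [cite: MagnenRivasseauSeneor1993, (VIII.1) p.377, p.378 tl.17] -/
theorem schwinger_poly_sq_nonneg {ι : Type*} [Fintype ι] (c : ι → ℝ) (n : ι → ℕ)
    (f : (k : ι) → Fin (n k) → Mode) (ρ : ℕ) :
    0 ≤ ∑ k, ∑ l, c k * c l * T.schwinger ρ (n k + n l) (Fin.append (f k) (f l)) := by
  rw [← integral_polyEval_sq]
  exact integral_nonneg fun A => sq_nonneg _

/-- **THE LIMIT SCHWINGER FUNCTIONS ARE A POSITIVE FUNCTIONAL ON THE POLYNOMIAL ALGEBRA.** Under the first half of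
the main statement, for every real polynomial `P = Σ_k c_k Π_j A(f_k j)` in finitely many field coordinates,
`Σ_{k,l} c_k c_l S_∞(f_k ++ f_l) ≥ 0` — i.e. `⟨P²⟩_∞ ≥ 0` in the only sense the sentence provides (a limit of
`⟨P²⟩_{ax,ρ} ≥ 0`). HONEST: this is what survives of «moments of a probability law» in the limit; it is NOT
Osterwalder–Schrader positivity (not claimed in print, p.327 tl.29–32) and does not produce a limiting measure.
[cite: MagnenRivasseauSeneor1993, p.327 tl.39–41, p.378 tl.17–22, p.327 tl.29–32] -/
theorem Slim_poly_sq_nonneg (huv : UVLimitExistsPrinted T.toAxialTheory) {ι : Type*} [Fintype ι] (c : ι → ℝ)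
    (n : ι → ℕ) (f : (k : ι) → Fin (n k) → Mode) :
    0 ≤ ∑ k, ∑ l, c k * c l * T.toAxialTheory.Slim (n k + n l) (Fin.append (f k) (f l)) := by
  have hlim : Tendsto (fun ρ => ∑ k, ∑ l, c k * c l * T.schwinger ρ (n k + n l) (Fin.append (f k) (f l))) atTop
      (𝓝 (∑ k, ∑ l, c k * c l * T.toAxialTheory.Slim (n k + n l) (Fin.append (f k) (f l)))) :=
    tendsto_finsetSum _ fun k _ => tendsto_finsetSum _ fun l _ =>
      (T.tendsto_schwinger_Slim huv _ _).const_mul _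
  exact ge_of_tendsto' hlim fun ρ => T.schwinger_poly_sq_nonneg c n f ρ

/-- The monomial at the two-point datum `![m, m′]` is the product of the two coordinates.
[cite: MagnenRivasseauSeneor1993, (VIII.1) p.377] -/
theorem monomial_pair (m m' : Mode) (A : Config) : monomial ![m, m'] A = A m * A m' := by
  simp [monomial, Fin.prod_univ_two]

/-- The two-point integrand as a function: `monomial ![m, m′] = (A ↦ A m · A m′)`.
[cite: MagnenRivasseauSeneor1993, (VIII.1) p.377] -/
theorem monomial_pair_eq (m m' : Mode) : (monomial ![m, m'] : Config → ℝ) = fun A => A m * A m' :=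
  funext fun A => monomial_pair m m' A

/-- Two coordinates, per cutoff: `⟨Ã(m)²⟩_{ax,ρ}s² + 2⟨Ã(m)Ã(m′)⟩_{ax,ρ}s + ⟨Ã(m′)²⟩_{ax,ρ} = ⟨(sÃ(m) + Ã(m′))²⟩_{ax,ρ}
≥ 0` for every real `s`. [cite: MagnenRivasseauSeneor1993, (VIII.1) p.377, p.378 tl.17] -/
theorem schwinger_quadratic_nonneg (ρ : ℕ) (m m' : Mode) (s : ℝ) :
    0 ≤ T.schwinger ρ 2 ![m, m] * (s * s) + 2 * T.schwinger ρ 2 ![m, m'] * s + T.schwinger ρ 2 ![m', m'] := by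
  have h1 : Integrable (fun A : Config => A m * A m) (T.law ρ) := by
    have := T.integrable ρ 2 ![m, m]; rwa [monomial_pair_eq] at this
  have h2 : Integrable (fun A : Config => A m * A m') (T.law ρ) := by
    have := T.integrable ρ 2 ![m, m']; rwa [monomial_pair_eq] at this
  have h3 : Integrable (fun A : Config => A m' * A m') (T.law ρ) := by
    have := T.integrable ρ 2 ![m', m']; rwa [monomial_pair_eq] at this
  have h12 : Integrable (fun A : Config => s * s * (A m * A m) + 2 * s * (A m * A m')) (T.law ρ) :=
    (h1.const_mul (s * s)).add (h2.const_mul (2 * s))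
  have hsq : 0 ≤ ∫ A, (s * A m + A m') ^ 2 ∂(T.law ρ) := integral_nonneg fun A => sq_nonneg _
  have hexp : ∫ A, (s * A m + A m') ^ 2 ∂(T.law ρ) =
      (∫ A, A m * A m ∂(T.law ρ)) * (s * s) + 2 * (∫ A, A m * A m' ∂(T.law ρ)) * s +
        ∫ A, A m' * A m' ∂(T.law ρ) := by
    have h : ∀ A : Config, (s * A m + A m') ^ 2 =
        s * s * (A m * A m) + 2 * s * (A m * A m') + A m' * A m' := fun A => by ring
    simp_rw [h]
    rw [integral_add h12 h3, integral_add (h1.const_mul (s * s)) (h2.const_mul (2 * s)), integral_const_mul,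
      integral_const_mul]
    ring
  unfold schwinger
  rw [monomial_pair_eq, monomial_pair_eq, monomial_pair_eq]
  linarith [hsq, hexp]

/-- Two coordinates, in the limit: `⟨Ã(m)²⟩_∞s² + 2⟨Ã(m)Ã(m′)⟩_∞s + ⟨Ã(m′)²⟩_∞ ≥ 0` for every real `s`.
[cite: MagnenRivasseauSeneor1993, p.327 tl.40–41, p.378 tl.17–22] -/
theorem Slim_quadratic_nonneg (huv : UVLimitExistsPrinted T.toAxialTheory) (m m' : Mode) (s : ℝ) :
    0 ≤ T.toAxialTheory.Slim 2 ![m, m] * (s * s) + 2 * T.toAxialTheory.Slim 2 ![m, m'] * s +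
      T.toAxialTheory.Slim 2 ![m', m'] := by
  have hlim : Tendsto (fun ρ => T.schwinger ρ 2 ![m, m] * (s * s) + 2 * T.schwinger ρ 2 ![m, m'] * s +
      T.schwinger ρ 2 ![m', m']) atTop (𝓝 (T.toAxialTheory.Slim 2 ![m, m] * (s * s) +
        2 * T.toAxialTheory.Slim 2 ![m, m'] * s + T.toAxialTheory.Slim 2 ![m', m'])) :=
    ((((T.tendsto_schwinger_Slim huv 2 ![m, m]).mul_const (s * s))).add
      (((T.tendsto_schwinger_Slim huv 2 ![m, m']).const_mul 2).mul_const s)).add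
      (T.tendsto_schwinger_Slim huv 2 ![m', m'])
  exact ge_of_tendsto' hlim fun ρ => T.schwinger_quadratic_nonneg ρ m m' s

/-- **Cauchy–Schwarz for the limit two-point function**: `⟨Ã(m)Ã(m′)⟩_∞² ≤ ⟨Ã(m)²⟩_∞ · ⟨Ã(m′)²⟩_∞` under the first
half of the main statement (the discriminant of the nonnegative quadratic `Slim_quadratic_nonneg`, Mathlib
`discrim_le_zero`). [cite: MagnenRivasseauSeneor1993, p.327 tl.40–41, p.378 tl.17–22] -/
theorem Slim_two_point_sq_le (huv : UVLimitExistsPrinted T.toAxialTheory) (m m' : Mode) :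
    T.toAxialTheory.Slim 2 ![m, m'] ^ 2 ≤ T.toAxialTheory.Slim 2 ![m, m] * T.toAxialTheory.Slim 2 ![m', m'] := by
  have h := discrim_le_zero fun s => T.Slim_quadratic_nonneg huv m m' s
  unfold discrim at h
  nlinarith [h]

/-- Concatenating two one-point data gives the two-point datum. [cite: MagnenRivasseauSeneor1993, (VIII.1) p.377] -/
theorem append_single_single (m m' : Mode) : Fin.append ![m] ![m'] = ![m, m'] := by
  funext i
  fin_cases i <;> rfl

/-- **The limit two-point function is a positive-semidefinite kernel on the modes**: for every finite family of modes
`m_k` and real coefficients `c_k`, `Σ_{k,l} c_k c_l ⟨Ã(m_k)Ã(m_l)⟩_∞ ≥ 0` (the degree-one case of `Slim_poly_sq_nonneg`).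
HONEST: a Gram-matrix statement about the limit VALUES; not reflection positivity. [cite: MagnenRivasseauSeneor1993, p.327 tl.40–41, p.378 tl.17–22] -/
theorem Slim_gram_nonneg (huv : UVLimitExistsPrinted T.toAxialTheory) {ι : Type*} [Fintype ι] (c : ι → ℝ)
    (m : ι → Mode) : 0 ≤ ∑ k, ∑ l, c k * c l * T.toAxialTheory.Slim 2 ![m k, m l] := by
  have h := T.Slim_poly_sq_nonneg huv c (fun _ => 1) (fun k => ![m k])
  simp only [append_single_single] at h
  exact h

/-- **Cauchy–Schwarz for arbitrary data, symmetrised**: for test data `f`, `g` of any arities, under the first half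
of the main statement, `(S_∞(f ++ g) + S_∞(g ++ f))² ≤ 4·S_∞(f ++ f)·S_∞(g ++ g)` — the two-term case (`ι = Bool`) of
`Slim_poly_sq_nonneg` and the discriminant. [cite: MagnenRivasseauSeneor1993, p.327 tl.40–41, p.378 tl.17–22] -/
theorem Slim_append_cauchySchwarz (huv : UVLimitExistsPrinted T.toAxialTheory) {N N' : ℕ} (f : Fin N → Mode)
    (g : Fin N' → Mode) :
    (T.toAxialTheory.Slim (N + N') (Fin.append f g) + T.toAxialTheory.Slim (N' + N) (Fin.append g f)) ^ 2 ≤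
      4 * T.toAxialTheory.Slim (N + N) (Fin.append f f) * T.toAxialTheory.Slim (N' + N') (Fin.append g g) := by
  have hq : ∀ s : ℝ, 0 ≤ T.toAxialTheory.Slim (N + N) (Fin.append f f) * (s * s) +
      (T.toAxialTheory.Slim (N + N') (Fin.append f g) + T.toAxialTheory.Slim (N' + N) (Fin.append g f)) * s +
      T.toAxialTheory.Slim (N' + N') (Fin.append g g) := by
    intro s
    have h := T.Slim_poly_sq_nonneg huv (ι := Bool) (fun b => cond b s 1) (fun b => cond b N N')
      (fun b => match b with | true => f | false => g)
    simp only [Fintype.sum_bool, Bool.cond_true, Bool.cond_false, mul_one, one_mul] at h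
    -- the arities `cond b N N'` inside the (type-dependent) index are definitionally `N`, `N'`
    have h' : 0 ≤ s * s * T.toAxialTheory.Slim (N + N) (Fin.append f f) +
        s * T.toAxialTheory.Slim (N + N') (Fin.append f g) +
        (s * T.toAxialTheory.Slim (N' + N) (Fin.append g f) + T.toAxialTheory.Slim (N' + N') (Fin.append g g)) := h
    linarith [h']
  have h := discrim_le_zero hq
  unfold discrim at h
  nlinarith [h]

/-! ## §3 Under the whole sentence: the Slavnov identities (VIII.6) for the limit functions, finitary form -/

/-- **(VIII.6) FOR THE LIMIT SCHWINGER FUNCTIONS, unfolded**: under `PrintedStatement`, for every `N` and every Ward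
test datum `x`, the pinned finitary left-hand side evaluated on `S_∞` equals the infrared correction:
`c₀(x) + Σ_k c_k(x)·S_∞(n_k, f_k) = E_N(x)` — «these functions in the ultraviolet limit satisfy the Slavnov
identities (VIII.6) adapted to the particular infrared cutoff chosen». Nothing is added to the hypothesis; this is
its second conjunct in the carrier's vocabulary. [cite: MagnenRivasseauSeneor1993, p.327 tl.41–43, (VIII.6) p.378] -/
theorem slavnov_finitary (h : T.PrintedStatement) (N : ℕ) (x : T.WTest N) :
    finitaryWard T.toAxialTheory.Slim (T.wardData N x) = T.E N x :=
  h.2 N x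

/-- **What a consumer of «MRS as hypothesis» gets, assembled**: every cut-off Schwinger function converges to a
normalised, symmetric, axial (`μ = 0` moments vanish) family `S_∞`, positive on squares of polynomials, which
satisfies (VIII.6) in the finitary form. [cite: MagnenRivasseauSeneor1993, p.327 tl.39–43, p.378 tl.17–22, (II.7) p.329] -/
theorem printedStatement_limit (h : T.PrintedStatement) :
    (∀ (N : ℕ) (f : Fin N → Mode), Tendsto (fun ρ => T.schwinger ρ N f) atTop (𝓝 (T.toAxialTheory.Slim N f))) ∧
      (∀ f : Fin 0 → Mode, T.toAxialTheory.Slim 0 f = 1) ∧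
      (∀ (N : ℕ) (f : Fin N → Mode) (σ : Equiv.Perm (Fin N)),
          T.toAxialTheory.Slim N (f ∘ σ) = T.toAxialTheory.Slim N f) ∧
      (∀ (N : ℕ) (f : Fin N → Mode), (∃ j, (f j).IsTime) → T.toAxialTheory.Slim N f = 0) ∧
      (∀ (m m' : Mode) (s : ℝ), 0 ≤ T.toAxialTheory.Slim 2 ![m, m] * (s * s) +
          2 * T.toAxialTheory.Slim 2 ![m, m'] * s + T.toAxialTheory.Slim 2 ![m', m']) ∧
      (∀ (N : ℕ) (x : T.WTest N), finitaryWard T.toAxialTheory.Slim (T.wardData N x) = T.E N x) :=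
  ⟨T.tendsto_schwinger_Slim h.1, T.Slim_empty, T.Slim_perm, T.Slim_time, T.Slim_quadratic_nonneg h.1,
    T.slavnov_finitary h⟩

/-- The degenerate witness of gen 0 seen through this interface: for the Dirac (zero-field) model every limit
Schwinger function of positive degree is `0` — the interface above is inhabited, and positivity on squares holds
there with equality; nothing printed excludes it (record §5, «vacuity frontier»).
[cite: MagnenRivasseauSeneor1993, p.327 tl.39–43] -/
theorem diracModel_Slim_two_point (par : Parameters) (WTest : ℕ → Type)
    (wardData : (N : ℕ) → WTest N → WardData) (m m' : Mode) :
    (diracModel par WTest wardData).toAxialTheory.Slim 2 ![m, m'] = 0 := by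
  rw [Slim_eq_limUnder]
  have h0 : (fun ρ => (diracModel par WTest wardData).schwinger ρ 2 ![m, m']) = fun _ => (0 : ℝ) := by
    funext ρ
    rw [diracModel_schwinger, monomial_pair]
    simp
  rw [h0]
  exact tendsto_const_nhds.limUnder_eq

end PinnedTheory

end MainStatement

end Literature.MathematicalPhysics.QuantumFieldTheory.MagnenRivasseauSeneor1993
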